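import Summits.HodgeConjecture.CorCM.Census.CyclicBoundarySlide
import Summits.HodgeConjecture.CorCM.Census.CoinvariantCyclic

/-!
# Boundary sets of cyclic CM types, III: the dictionary `CMF G c → Finset (ℤ/n)` along a generator

COR-CM (cell `pub-hodgecm2`), count-neutral kernel combinatorics by the binder seat b23 (gen 38; lane CYCLIC-FACES, part III, sequel of
`Census/CyclicBoundaryWindows` / `…Slide`; independent of part II `…Descent`).  One bookkeeping definition (`bd`, the boundary set of an abstract CM type along a
generator) and dictionary theorems, on top of seat b09's intrinsic model of abstract CM types (`CMF G c`, base change `rt`, flips `oflipCM`,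
places `orb`, `Census/BlockParityLaw.lean` & co., consumed BY NAME, nothing restated).  No certificate, no `decide` table, no named fact, no
geometry, no `sorry`.  HONEST FRAMING: `HC_CM` is NOT proved, here or anywhere in the tree; nothing here is a period or a headline.

SETTING.  `G` a finite group generated by `g` of order `2n`, `c = gⁿ` (the involution of a cyclic group of even order), `Ψ : CMF G c` an
abstract CM type (`x ∈ Ψ ↔ c·x ∉ Ψ`).  **`bd c g n Ψ ⊂ ℤ/n`** is the set of `k` such that exactly one of `g^k`, `g^{k+1}` lies in `Ψ` — well
defined on `ℤ/n` because multiplying by `c = gⁿ` flips both memberships (`mem_bd_natCast`).  The dictionary (all [folklore]):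
* §2 base change: `bd (Ψ·g⁻¹) = bd Ψ − 1` (`bd_rt_gen`), hence `|bd|` and the potential `pot ∘ bd` of part I are invariant under every base
  change (`card_bd_rt`, `pot_bd_rt`); conjugation `Ψ ↦ Ψ·c = Ψ̄` does not change `bd` (`bd_rt_self`);
* §3 places: `g^i` lies in the place `{g^j, c·g^j}` iff `i ≡ j (mod n)` (`pow_mem_orb_iff`), and **the flip at the place of `g^j` toggles the
  two boundaries `j − 1`, `j`**: `bd (Ψ^{(g^j)}) = bd Ψ ∆ {j − 1, j}` (`bd_oflipCM`, `n ≥ 2`);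
* §4 **parity**: `|bd Ψ|` is odd (`odd_card_bd`) — walking from `g⁰` to `gⁿ = c·g⁰` the membership flips an odd number of times;
* §5 **injectivity modulo conjugation**: `bd Ψ = bd Ψ'` iff `Ψ' ∈ {Ψ, Ψ̄}` (`eq_or_eq_rt_of_bd_eq`).
Part IV (`Census/CyclicFacesGenerate.lean`) runs the face descent of part II through this dictionary.

## References
* [Pohlmann1968] H. Pohlmann, Algebraic cycles on abelian varieties of complex multiplication type, Ann. of Math. 88 (1968), Thm 1.
* [Milne1999] J. S. Milne, Lefschetz motives and the Tate conjecture, Compositio Math. 117 (1999), Prop. 2.1, p. 54.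
-/

namespace Summit.HodgeConjecture.CorCM.Census.CyclicFaces

open Finset
open scoped symmDiff
open Summit.HodgeConjecture.CorCM.Prior.AllgGroup.RfwfAllgGroup
open Summit.HodgeConjecture.CorCM.Census.BlockParity
open Summit.HodgeConjecture.CorCM.Census.CyclicBoundary

noncomputable section

variable {G : Type*} [Group G] [Fintype G] [DecidableEq G] (c : G) (g : G) {n : ℕ}

/-! ## §1 The boundary set along a generator -/

/-- **The boundary set** of the abstract CM type `Ψ` along the generator `g` (with `gⁿ = c`): the `k ∈ ℤ/n` such that exactly one of
`g^k`, `g^{k+1}` lies in `Ψ`. [folklore] -/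
def bd (n : ℕ) [NeZero n] (Ψ : CMF G c) : Finset (ZMod n) :=
  Finset.univ.filter fun k : ZMod n => ¬ ((g ^ k.val ∈ Ψ.1) ↔ (g ^ (k.val + 1) ∈ Ψ.1))

/-- Membership in the boundary set. [folklore] -/
theorem mem_bd_iff [NeZero n] (Ψ : CMF G c) (k : ZMod n) :
    k ∈ bd c g n Ψ ↔ ¬ ((g ^ k.val ∈ Ψ.1) ↔ (g ^ (k.val + 1) ∈ Ψ.1)) := by
  unfold bd
  rw [Finset.mem_filter]
  simp only [Finset.mem_univ, true_and]

omit [Fintype G] [DecidableEq G] in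
/-- `g^j` and `c` commute (`c = gⁿ`). [folklore] -/
theorem pow_mul_c (hgn : g ^ n = c) (j : ℕ) : g ^ j * c = c * g ^ j := by
  rw [← hgn]; exact pow_mul_comm g j n

/-- **Multiplying the exponent by `gⁿ = c` flips membership**: `g^{j+n} ∈ Ψ ↔ g^j ∉ Ψ`. [folklore] -/
theorem pow_add_n_mem_iff (hgn : g ^ n = c) (Ψ : CMF G c) (j : ℕ) : g ^ (j + n) ∈ Ψ.1 ↔ g ^ j ∉ Ψ.1 := by
  rw [pow_add, hgn, pow_mul_c c g hgn]
  have h := Ψ.2 (g ^ j)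
  constructor
  · intro hc hj; exact (h.mp hj) hc
  · intro hj; by_contra hc; exact hj (by rw [h]; exact hc)

/-- `c·g^j ∈ Ψ ↔ g^j ∉ Ψ`. [folklore] -/
theorem c_mul_pow_mem_iff (hgn : g ^ n = c) (Ψ : CMF G c) (j : ℕ) : c * g ^ j ∈ Ψ.1 ↔ g ^ j ∉ Ψ.1 := by
  have h := pow_add_n_mem_iff c g hgn Ψ j
  rwa [pow_add, hgn, pow_mul_c c g hgn] at h

/-- The boundary condition is `n`-periodic in the exponent. [folklore] -/
theorem bdry_add_n (hgn : g ^ n = c) (Ψ : CMF G c) (j : ℕ) :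
    (¬ ((g ^ (j + n) ∈ Ψ.1) ↔ (g ^ (j + n + 1) ∈ Ψ.1))) ↔ ¬ ((g ^ j ∈ Ψ.1) ↔ (g ^ (j + 1) ∈ Ψ.1)) := by
  have h1 := pow_add_n_mem_iff c g hgn Ψ j
  have h2 := pow_add_n_mem_iff c g hgn Ψ (j + 1)
  rw [show j + n + 1 = j + 1 + n from by ring, h1, h2]
  tauto

/-- … and `n·m`-periodic. [folklore] -/
theorem bdry_add_mul (hgn : g ^ n = c) (Ψ : CMF G c) (j m : ℕ) :
    (¬ ((g ^ (j + n * m) ∈ Ψ.1) ↔ (g ^ (j + n * m + 1) ∈ Ψ.1))) ↔ ¬ ((g ^ j ∈ Ψ.1) ↔ (g ^ (j + 1) ∈ Ψ.1)) := by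
  induction m with
  | zero => simp
  | succ m ih =>
    rw [show j + n * (m + 1) = j + n * m + n from by ring, bdry_add_n c g hgn Ψ (j + n * m)]
    exact ih

/-- **Membership of a natural exponent class**: `(j : ℤ/n) ∈ bd Ψ` iff exactly one of `g^j`, `g^{j+1}` lies in `Ψ`. [folklore] -/
theorem mem_bd_natCast [NeZero n] (hgn : g ^ n = c) (Ψ : CMF G c) (j : ℕ) :
    ((j : ℕ) : ZMod n) ∈ bd c g n Ψ ↔ ¬ ((g ^ j ∈ Ψ.1) ↔ (g ^ (j + 1) ∈ Ψ.1)) := by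
  rw [mem_bd_iff, ZMod.val_natCast]
  have h := bdry_add_mul c g hgn Ψ (j % n) (j / n)
  rw [Nat.mod_add_div j n] at h
  rw [← h]

/-! ## §2 Base change -/

/-- **Base change along the generator shifts the boundary set**: `k ∈ bd (Ψ·g⁻¹) ↔ k + 1 ∈ bd Ψ`. [folklore] -/
theorem mem_bd_rt_gen [NeZero n] (hgn : g ^ n = c) (Ψ : CMF G c) (k : ZMod n) :
    k ∈ bd c g n (rt c g Ψ) ↔ k + 1 ∈ bd c g n Ψ := by
  have hk : k + 1 = ((k.val + 1 : ℕ) : ZMod n) := by push_cast; rw [ZMod.natCast_zmod_val]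
  rw [mem_bd_iff, hk, mem_bd_natCast c g hgn, mem_rt, mem_rt, ← pow_succ, ← pow_succ]

/-- `bd (Ψ·g⁻¹) = bd Ψ − 1`. [folklore] -/
theorem bd_rt_gen [NeZero n] (hgn : g ^ n = c) (Ψ : CMF G c) :
    bd c g n (rt c g Ψ) = (bd c g n Ψ).image (fun y => y + -1) := by
  ext k
  rw [mem_bd_rt_gen c g hgn, mem_shift, sub_neg_eq_add]

/-- **The size and the potential of the boundary set are base-change invariants.** [folklore] -/
theorem card_pot_bd_rt [NeZero n] (hgn : g ^ n = c) (hgen : ∀ x : G, x ∈ Submonoid.powers g) (Q : G) (Ψ : CMF G c) :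
    (bd c g n (rt c Q Ψ)).card = (bd c g n Ψ).card ∧ pot (bd c g n (rt c Q Ψ)) = pot (bd c g n Ψ) := by
  obtain ⟨j, rfl⟩ := (Submonoid.mem_powers_iff _ _).mp (hgen Q)
  induction j generalizing Ψ with
  | zero => rw [pow_zero, rt_one]; exact ⟨rfl, rfl⟩
  | succ j ih =>
    rw [pow_succ, rt_mul]
    obtain ⟨h1, h2⟩ := ih (rt c g Ψ)
    rw [h1, h2, bd_rt_gen c g hgn, card_shift, pot_shift]
    exact ⟨rfl, rfl⟩

/-- `|bd (Ψ·Q⁻¹)| = |bd Ψ|`. [folklore] -/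
theorem card_bd_rt [NeZero n] (hgn : g ^ n = c) (hgen : ∀ x : G, x ∈ Submonoid.powers g) (Q : G) (Ψ : CMF G c) :
    (bd c g n (rt c Q Ψ)).card = (bd c g n Ψ).card := (card_pot_bd_rt c g hgn hgen Q Ψ).1

/-- `pot (bd (Ψ·Q⁻¹)) = pot (bd Ψ)`. [folklore] -/
theorem pot_bd_rt [NeZero n] (hgn : g ^ n = c) (hgen : ∀ x : G, x ∈ Submonoid.powers g) (Q : G) (Ψ : CMF G c) :
    pot (bd c g n (rt c Q Ψ)) = pot (bd c g n Ψ) := (card_pot_bd_rt c g hgn hgen Q Ψ).2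

/-- **Conjugation does not change the boundary set**: `bd (Ψ·c) = bd Ψ`. [folklore] -/
theorem bd_rt_self [NeZero n] (hgn : g ^ n = c) (Ψ : CMF G c) : bd c g n (rt c c Ψ) = bd c g n Ψ := by
  ext k
  rw [mem_bd_iff, mem_bd_iff, mem_rt, mem_rt, pow_mul_c c g hgn, pow_mul_c c g hgn, c_mul_pow_mem_iff c g hgn,
    c_mul_pow_mem_iff c g hgn]
  tauto

/-! ## §3 Places and flips -/

omit [Fintype G] [DecidableEq G] in
/-- Powers of an involution. [folklore] -/
theorem pow_invol (hc2 : c * c = 1) (m : ℕ) : c ^ m = 1 ∨ c ^ m = c := by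
  induction m with
  | zero => exact Or.inl (pow_zero c)
  | succ m ih =>
    rw [pow_succ]
    rcases ih with h | h
    · rw [h, one_mul]; exact Or.inr rfl
    · rw [h, hc2]; exact Or.inl rfl

omit [Fintype G] [DecidableEq G] in
/-- Splitting an exponent along `n`: `g^i = g^{i mod n} · c^{⌊i/n⌋}`. [folklore] -/
theorem pow_eq_pow_mod_mul (hgn : g ^ n = c) (i : ℕ) : g ^ i = g ^ (i % n) * c ^ (i / n) := by
  conv_lhs => rw [← Nat.mod_add_div i n]
  rw [pow_add, pow_mul, hgn]

omit [Fintype G] in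
/-- **`g^i` lies in the place `{g^j, c·g^j}` iff `i ≡ j (mod n)`.** [folklore] -/
theorem pow_mem_orb_iff (hgn : g ^ n = c) (hc2 : c * c = 1) (hord : orderOf g = 2 * n) (i j : ℕ) :
    g ^ i ∈ orb c (g ^ j) ↔ (i : ZMod n) = (j : ZMod n) := by
  rw [mem_orb, ZMod.natCast_eq_natCast_iff]
  constructor
  · have hdvd : n ∣ 2 * n := Dvd.intro_left 2 rfl
    rintro (h | h)
    · rw [pow_eq_pow_iff_modEq, hord] at h
      exact Nat.ModEq.of_dvd hdvd h
    · rw [← hgn, ← pow_add, pow_eq_pow_iff_modEq, hord] at h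
      exact (Nat.ModEq.of_dvd hdvd h).trans (Nat.add_modEq_left)
  · intro h
    have hi := pow_eq_pow_mod_mul c g hgn i
    have hj := pow_eq_pow_mod_mul c g hgn j
    rw [show i % n = j % n from h] at hi
    have hcomm : g ^ (j % n) * c = c * g ^ (j % n) := pow_mul_c c g hgn _
    rcases pow_invol c hc2 (i / n) with hi' | hi' <;> rcases pow_invol c hc2 (j / n) with hj' | hj' <;>
      rw [hi'] at hi <;> rw [hj'] at hj
    · exact Or.inl (by rw [hi, hj])
    · refine Or.inr ?_
      rw [hi, hj, hcomm, ← mul_assoc, hc2, one_mul, mul_one]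
    · exact Or.inr (by rw [hi, hj, mul_one, hcomm])
    · exact Or.inl (by rw [hi, hj])

/-- Membership in a flipped type, as an exclusive or. [folklore] -/
theorem mem_oflipCM_iff (hc2 : c * c = 1) (t : G) (Ψ : CMF G c) (x : G) :
    x ∈ (oflipCM c hc2 t Ψ).1 ↔ ¬ (x ∈ Ψ.1 ↔ x ∈ orb c t) := by
  change x ∈ Ψ.1 ∆ orb c t ↔ _
  rw [Finset.mem_symmDiff]
  tauto

/-- **The flip at the place of `g^j` toggles the boundaries `j − 1` and `j`**: `bd (Ψ^{(g^j)}) = bd Ψ ∆ {j − 1, j}` (`n ≥ 2`).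
[folklore] -/
theorem bd_oflipCM [NeZero n] (hgn : g ^ n = c) (hc2 : c * c = 1) (hord : orderOf g = 2 * n) (hn : 2 ≤ n) (j : ℕ)
    (Ψ : CMF G c) :
    bd c g n (oflipCM c hc2 (g ^ j) Ψ) = bd c g n Ψ ∆ {(j : ZMod n) - 1, (j : ZMod n)} := by
  ext k
  rw [Finset.mem_symmDiff, mem_bd_iff, mem_bd_iff, mem_oflipCM_iff, mem_oflipCM_iff, pow_mem_orb_iff c g hgn hc2 hord,
    pow_mem_orb_iff c g hgn hc2 hord, Finset.mem_insert, Finset.mem_singleton, ZMod.natCast_zmod_val, Nat.cast_succ,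
    ZMod.natCast_zmod_val]
  have hex : ¬ (k = (j : ZMod n) ∧ k + 1 = (j : ZMod n)) := by
    rintro ⟨h1, h2⟩
    rw [h1] at h2
    have h3 : ((1 : ℕ) : ZMod n) = 0 := by
      rw [Nat.cast_one]
      have := congrArg (fun y => y - (j : ZMod n)) h2
      simpa using this
    have := Nat.eq_zero_of_dvd_of_lt ((ZMod.natCast_eq_zero_iff _ _).mp h3) (by omega : 1 < n)
    omega
  have hiff : (k = (j : ZMod n) - 1) ↔ (k + 1 = (j : ZMod n)) := by
    constructor
    · intro h; rw [h, sub_add_cancel]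
    · intro h; rw [← h, add_sub_cancel_right]
  rw [hiff]
  tauto

/-! ## §4 Parity: `|bd Ψ|` is odd -/

/-- The boundary set counted on natural representatives. [folklore] -/
theorem card_bd_eq [NeZero n] (Ψ : CMF G c) :
    (bd c g n Ψ).card = ((Finset.range n).filter fun j => ¬ ((g ^ j ∈ Ψ.1) ↔ (g ^ (j + 1) ∈ Ψ.1))).card := by
  refine Finset.card_bij (fun k _ => k.val) ?_ ?_ ?_
  · intro k hk
    rw [Finset.mem_filter, Finset.mem_range]
    exact ⟨ZMod.val_lt k, (mem_bd_iff c g Ψ k).mp hk⟩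
  · intro k _ k' _ h
    exact ZMod.val_injective n h
  · intro j hj
    rw [Finset.mem_filter, Finset.mem_range] at hj
    refine ⟨(j : ZMod n), ?_, ZMod.val_cast_of_lt hj.1⟩
    rw [mem_bd_iff, ZMod.val_cast_of_lt hj.1]
    exact hj.2

/-- **The number of boundaries below `m` is even iff `g⁰` and `g^m` are on the same side of `Ψ`.** [folklore] -/
theorem even_card_filter_iff (Ψ : CMF G c) (m : ℕ) :
    Even ((Finset.range m).filter fun j => ¬ ((g ^ j ∈ Ψ.1) ↔ (g ^ (j + 1) ∈ Ψ.1))).card ↔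
      ((g ^ 0 ∈ Ψ.1) ↔ (g ^ m ∈ Ψ.1)) := by
  induction m with
  | zero => simp
  | succ m ih =>
    rw [Finset.range_add_one, Finset.filter_insert]
    by_cases hm : ¬ ((g ^ m ∈ Ψ.1) ↔ (g ^ (m + 1) ∈ Ψ.1))
    · rw [if_pos hm, Finset.card_insert_of_notMem (fun h => by simp at h), Nat.even_add_one, ih]
      tauto
    · rw [if_neg hm, ih]
      tauto

/-- **The boundary set has odd size** (`g⁰ = 1` and `gⁿ = c` are on opposite sides of every CM type). [folklore] -/
theorem odd_card_bd [NeZero n] (hgn : g ^ n = c) (Ψ : CMF G c) : Odd (bd c g n Ψ).card := by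
  rw [card_bd_eq, ← Nat.not_even_iff_odd, even_card_filter_iff]
  have h := pow_add_n_mem_iff c g hgn Ψ 0
  rw [zero_add] at h
  rw [h]
  tauto

/-- Hence a boundary set which is not a singleton has at least three members. [folklore] -/
theorem three_le_card_bd [NeZero n] (hgn : g ^ n = c) (Ψ : CMF G c) (h1 : (bd c g n Ψ).card ≠ 1) : 3 ≤ (bd c g n Ψ).card := by
  obtain ⟨m, hm⟩ := odd_card_bd c g hgn Ψ
  omega

/-! ## §5 Injectivity modulo conjugation -/

/-- Two types with the same boundary set agree at `g^m` iff they agree at `g⁰`. [folklore] -/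
theorem mem_iff_mem_of_bd_eq [NeZero n] (hgn : g ^ n = c) {Ψ Ψ' : CMF G c} (h : bd c g n Ψ = bd c g n Ψ') (m : ℕ) :
    ((g ^ m ∈ Ψ.1) ↔ (g ^ m ∈ Ψ'.1)) ↔ ((g ^ 0 ∈ Ψ.1) ↔ (g ^ 0 ∈ Ψ'.1)) := by
  induction m with
  | zero => exact Iff.rfl
  | succ m ih =>
    have hb := mem_bd_natCast c g hgn Ψ m
    rw [h, mem_bd_natCast c g hgn Ψ' m] at hb
    tauto

/-- **A type is determined by its boundary set up to conjugation**: `bd Ψ = bd Ψ' → Ψ' = Ψ ∨ Ψ' = Ψ·c`. [folklore] -/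
theorem eq_or_eq_rt_of_bd_eq [NeZero n] (hgn : g ^ n = c) (hgen : ∀ x : G, x ∈ Submonoid.powers g) {Ψ Ψ' : CMF G c}
    (h : bd c g n Ψ = bd c g n Ψ') : Ψ' = Ψ ∨ Ψ' = rt c c Ψ := by
  by_cases h0 : (g ^ 0 ∈ Ψ.1) ↔ (g ^ 0 ∈ Ψ'.1)
  · left
    apply Subtype.ext
    ext x
    obtain ⟨m, rfl⟩ := (Submonoid.mem_powers_iff _ _).mp (hgen x)
    exact ((mem_iff_mem_of_bd_eq c g hgn h m).mpr h0).symm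
  · right
    apply Subtype.ext
    ext x
    obtain ⟨m, rfl⟩ := (Submonoid.mem_powers_iff _ _).mp (hgen x)
    have hm := mem_iff_mem_of_bd_eq c g hgn h m
    rw [mem_rt, pow_mul_c c g hgn, c_mul_pow_mem_iff c g hgn]
    tauto

end

end Summit.HodgeConjecture.CorCM.Census.CyclicFaces
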